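import Summits.Ventures.AbcSig.Rows.Bridge
import Summits.Ventures.AbcSig.Rows.C2aL73A2
import Summits.Ventures.AbcSig.Rows.C2aL73A2AB

/-!
# Venture AbcSig — CELL `C2aL73A2`: the census statement `Rows.C2aCellRed 73 (fun a => a = 2) ∅` from the two row theorems

HONEST FRAMING. COMPUTATION cell `pub-abcsig`; CONDITIONAL theorem; no claim on ABC or any summit. Hypotheses exactly as in
`Rows/C2aL73A2.lean` and `Rows/C2aL73A2AB.lean`: `BS04Package` (CITED), `DataComplete` / `RefinesCPSymAll` (COMPUTED, certified level files;
norm-form certificates), `EisPackage` (CITED) + `Refines` (COMPUTED) for the kernel M6 discharges, and the rows' per-orbit CITED exclusions universally quantified in the exponent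
(suffix `_d1` for `famB`, `_d2` for `famAB`). Conclusion = p1's census predicate (`Rows/Statements.lean`) with the residual of the row of
record `census/rows/C2a/C2a-l73-a2.md` (sha16 `73a4ca6963e93f5a`): all four coprime distributions `A·B = 2^2·73^m`, reduced exponents.
GENERATED by p-lean g4 `gen4/c2arow2.py` (pattern of `Rows/C2aL277A0XCell.lean`).
-/

namespace Summit.Ventures.AbcSig

/-- Cell `C2aL73A2`: `Rows.C2aCellRed 73 (fun a => a = 2) ∅` under the rows' hypotheses. -/
theorem xcell_C2aL73A2 (M : NewformModel) (hP : M.BS04Package)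
    (hE : M.EisPackage)
    (hR_orbit_146_2 : M.Refines 146 orbit_146_2 m6X_146_2)
    (hD292 : M.DataComplete 292 level292Orbits) (hCP292 : M.RefinesCPSymAll 292 level292CP)
    (hD584 : M.DataComplete 584 level584Orbits)
    (hD146 : M.DataComplete 146 level146Orbits)
    (hX_orbit_584_1_d1 : ∀ n m : ℕ, n ∈ ([11] : List ℕ) → M.Excludes 584 orbit_584_1 (famB (2 ^ 2 * 73 ^ m) n (fun _ _ => True)))
    (hX_orbit_584_1_d2 : ∀ n m : ℕ, n ∈ ([11] : List ℕ) → M.Excludes 584 orbit_584_1 (famAB (73 ^ m) (2 ^ 2) n (fun _ _ => True))) :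
    Rows.C2aCellRed 73 (fun a => a = 2) ∅ :=
  C2aCellRed_of_rows 73 (by norm_num) (by norm_num) _ _
    (fun n hn h11 hnℓ _ a m (ha : a = 2) han hm hmn x y z h1 h2 => by
      subst ha
      exact xrow_C2aL73A2 M hP hE hR_orbit_146_2 hD292 hCP292 hD584 hD146 n hn h11 hnℓ  m hm hmn (hX_orbit_584_1_d1 n m) x y z h1 h2)
    (fun n hn h11 hnℓ _ a m (ha : a = 2) han hm hmn x y z h1 h2 => by
      subst ha
      exact xrow_C2aL73A2AB M hP hE hR_orbit_146_2 hD292 hCP292 hD584 hD146 n hn h11 hnℓ  m hm hmn (hX_orbit_584_1_d2 n m) x y z h1 h2)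

end Summit.Ventures.AbcSig
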